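import Mathlib
import Summits.NavierStokesRegularity.NavierStokesRegularity.Theorems.EulerZoomLiouvillePowerGaugeEulerLiouvilleSelfSimilarProfileMember
import Summits.NavierStokesRegularity.NavierStokesRegularity.Theorems.PowerGaugeEulerLiouville.Negative.BudgetedClassicalAncientFlow

/-!
# Crux `EulerZoomLiouville.PowerGaugeEulerLiouville` (stmt-NavierStokesRegularity-19832) — negative edge, PROFILE form:
# ONE `C²` CIV profile pair with three finite own-rate weights refutes the crux

Negative-lane record (prover hand leafhand-ns-eulerzoomliouville-8 g0; `--supports` stmt-19832).  The lineage's
PROFILE ⇒ MEMBER dictionary (`ProfileMember.exists_inClass_of_profile`, ns-ezl-w6 g2) says that a `C²` solution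
`(V, P′)` of the Constantin–Ignatova–Vicol profile system (3.3) with `γ = 1/(2+ρ)`, `−½ < ρ < 1`, carrying the three
own-rate weights at infinity `∫_{B_L}|V|² ≤ N L^{1−2ρ}` (`L ≥ 1`), `∫_{|y|≥1}|∇V|²_F |y|^{ρ−1} < ∞`,
`∫_{|y|≥1}|P′|^{3/2}|y|^{2ρ−2} < ∞`, generates an exactly self-similar member of Seregin's class with exponent `ρ`.
This file draws the conclusion for the crux in kernel form (the «re-seat trigger (b)» of the leaf hands' census):

* `powerGaugeEulerLiouville_false_of_profile`: for `0 < ρ < 1`, ONE such pair with `V(y₀) ≠ 0` at one point refutes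
  `PowerGaugeEulerLiouville` — the member is continuous on the slab and equals `V` on the slice `τ = −1`, so it is not
  a.e. zero (`Negative.not_ae_eq_zero_of_continuousOn`).

For `½ < ρ < 1` the crux is PROVED at that exponent (Seregin's rung, `stub_largeRho`), so such profiles do not exist
there; the live window is `0 < ρ ≤ ½` = Chae–Shvydkoy's `1 < α = 1+ρ ≤ 3/2` (extremal tails `|V| ∼ |y|^{−(1+ρ)}`).
WHAT THIS IS NOT: not a refutation of the crux, of a stub, or of the route; not a claim about Navier–Stokes; no
profile is constructed here and none is known. [folklore; ConstantinIgnatovaVicol2026Putative §3.1.1 (3.2)–(3.3)] -/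

noncomputable section
set_option linter.dupNamespace false
namespace Summit.NavierStokesRegularity.NavierStokesRegularity.Theorems.PowerGaugeEulerLiouville.Negative

open MeasureTheory Set Function Filter Topology Metric Literature.Analysis Literature.Analysis.FluidPDE
open scoped NNReal ENNReal

/-- On the slice `τ = −1` the self-similar ansatz with blow-up time `0` IS the profile. [folklore] -/
theorem selfSimilarCollapse_neg_one (γ : ℝ) (V : EuclideanSpace ℝ (Fin 3) → EuclideanSpace ℝ (Fin 3))
    (x : EuclideanSpace ℝ (Fin 3)) : selfSimilarCollapse γ 0 V (-1) x = V x := by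
  simp [selfSimilarCollapse_apply]

/-- **NEGATIVE EDGE, PROFILE FORM (¬ crux modulo one weighted `C²` CIV profile).**  Let `0 < ρ < 1` and let `(V, P′)`
be a `C²`/`C¹` solution of the CIV profile system with `γ = 1/(2+ρ)` and centre `0`, with the three finite own-rate
weights at infinity, and `V y₀ ≠ 0` for some `y₀`.  Then `PowerGaugeEulerLiouville` (stmt-19832) FAILS: the ansatz
`(selfSimilarCollapse γ 0 V, selfSimilarCollapsePressure γ 0 P′)` with its classical gradient is a class member
(`ProfileMember.exists_inClass_of_profile`) which is continuous on the slab and nonzero at `(−1, y₀)`. [folklore] -/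
theorem powerGaugeEulerLiouville_false_of_profile {ρ : ℝ} (hρ0 : 0 < ρ) (hρ1 : ρ < 1)
    {V : EuclideanSpace ℝ (Fin 3) → EuclideanSpace ℝ (Fin 3)} {P : EuclideanSpace ℝ (Fin 3) → ℝ}
    (hprof : IsSelfSimilarEulerProfile (1 / (2 + ρ)) 0 V P) {N : ℝ≥0}
    (hA : ∀ L : ℝ, 1 ≤ L →
      ∫⁻ y in ball (0 : EuclideanSpace ℝ (Fin 3)) L, ‖V y‖ₑ ^ 2 ≤ (N : ℝ≥0∞) * ENNReal.ofReal (L ^ (1 - 2 * ρ)))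
    (hE : ∫⁻ y in {y : EuclideanSpace ℝ (Fin 3) | 1 ≤ ‖y‖},
      ENNReal.ofReal (frobeniusNormSq (fderiv ℝ V y)) * ENNReal.ofReal (‖y‖ ^ (ρ - 1)) ≠ ⊤)
    (hD : ∫⁻ y in {y : EuclideanSpace ℝ (Fin 3) | 1 ≤ ‖y‖},
      ‖P y‖ₑ ^ (3 / 2 : ℝ) * ENNReal.ofReal (‖y‖ ^ (2 * ρ - 2)) ≠ ⊤)
    {y₀ : EuclideanSpace ℝ (Fin 3)} (hne : V y₀ ≠ 0) :
    ¬ Summit.NavierStokesRegularity.NavierStokesRegularity.Theses.EulerZoomLiouville.PowerGaugeEulerLiouville := by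
  intro hcrux
  obtain ⟨c, hsw, hH, hc⟩ := ProfileMember.exists_inClass_of_profile (by linarith) hρ1 hprof hA hE hD
  have hae := hcrux ρ hρ0 _ _ _ c hsw hH hc
  have hcont : ContinuousOn (uncurry (selfSimilarCollapse (1 / (2 + ρ)) 0 V))
      (Iio (0 : ℝ) ×ˢ (univ : Set (EuclideanSpace ℝ (Fin 3)))) :=
    (ProfileMember.contDiffOn_uncurry_selfSimilarCollapse (n := 0) (hprof.contDiff_velocity.of_le (by norm_num))).continuousOn
  have hne' : selfSimilarCollapse (1 / (2 + ρ)) 0 V (-1) y₀ ≠ 0 := by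
    rwa [selfSimilarCollapse_neg_one]
  exact not_ae_eq_zero_of_continuousOn hcont (by norm_num) hne' hae

end Summit.NavierStokesRegularity.NavierStokesRegularity.Theorems.PowerGaugeEulerLiouville.Negative
end
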